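import Summits.CriticalPhenomena.PercolationContinuityZ3.Theorems.SahiMasterFamilyUCBernsteinRootable
import Summits.CriticalPhenomena.PercolationContinuityZ3.Theorems.SahiMasterFamilyUCBernsteinNestedLayers

/-!
# (B) for rootable pairs in the language of `…UCBernstein`: `layerSum ≥ 0`

Unit `prim-masterthm-p4` (gen 22; crux anchor stmt-CriticalPhenomena-4575, helper work; memo
`run/shared/lean/prim/prim-masterthm/prim-masterthm-p4/P4-GEN22-REPORT.md` §2c).  Combines `…UCBernsteinRootable` (`bpos_phiSet_mix_of_rootable`: the edge polynomial of a
rootable pair of union-closed families is `BPos (n+1)`) with the bridge of `…UCBernsteinNestedLayers` (namespace `UCBernsteinNested`; `BPos` ⇒ every degree-`(n+1)` Bernstein coefficient = patchwork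
layer sum is `≥ 0`): **`layerSum_nonneg_of_rootable`** — conjecture (B) (`UCBernsteinNonneg`'s conclusion, two-family slice with labels `Bool`) for every rootable pair,
every order.  HONEST FRAMING: (B) for general pairs, `UCHullNonneg k` (k ≥ 8), Sahi's `C_k` and the master theorem remain OPEN.  Axioms standard. [this work]
-/

noncomputable section

open scoped Classical

namespace Summit.CriticalPhenomena.PercolationContinuityZ3.Theorems

namespace UCBernsteinRootable

open Finset Function
open Literature.Combinatorics.Sahi2008
open PrincipalCapBeta (phiSet)
open BernsteinPos UCBernsteinNested

variable {n : ℕ}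

/-- **(B) for rootable pairs in the language of `…UCBernstein`**: every layer sum of a rootable pair of union-closed families is `≥ 0`. [this work] -/
theorem layerSum_nonneg_of_rootable {𝒰 𝒱 : Finset (Finset (Fin (n + 1)))} (hr : Rootable n 𝒰 𝒱)
    (hU : ∀ A ∈ 𝒰, ∀ B ∈ 𝒰, A ∪ B ∈ 𝒰) (hV : ∀ A ∈ 𝒱, ∀ B ∈ 𝒱, A ∪ B ∈ 𝒱) (j : Bool → ℕ) :
    0 ≤ UCBernstein.layerSum (fun b : Bool => if b then 𝒰 else 𝒱) j := by
  by_cases hj : j true + j false = n + 1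
  · have hjs : j = fun b => if b then n + 1 - j false else j false := by
      funext b; cases b
      · rfl
      · show j true = n + 1 - j false
        omega
    have key := bernstein_coeff_nonneg_of_bpos (bpos_phiSet_mix_of_rootable hr hU hV)
      (fun s => UCBernstein.layerSum (fun b : Bool => if b then 𝒰 else 𝒱) (fun b => if b then n + 1 - s else s))
      (fun w => phiSet_mix_eq_sum_layerSum 𝒰 𝒱 w) (j false) (by omega)
    rw [hjs]
    exact key
  · rw [layerSum_eq_zero_of_ne _ j hj]

end UCBernsteinRootable

end Summit.CriticalPhenomena.PercolationContinuityZ3.Theorems
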